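import Literature.NumberTheory.Automorphic.LevelActionAnnihilatorTransport
import Literature.NumberTheory.Automorphic.LevelActionSectionsExact
import Literature.NumberTheory.Automorphic.LevelControlExactSequences
import HarnessLib

/-!
# The coefficient sequences `0 → ℤ/p^a → ℤ/p^{a+b} → ℤ/p^b → 0` in the Hida tower

Topic `NumberTheory/Automorphic`; namespaces `Literature.NumberTheory.Automorphic.ModPowSeq` (the
maps of `ℤ/p^t`-modules) and `Literature.NumberTheory.Automorphic.BigHeckeGLn.TameLevel`; definitions
with bodies and theorems; no named fact, no `sorry`.

For the trivial-coefficient level-action cohomology `H^i(U(b',c'), 1; ℤ/p^t)` of `GL₂` (tame level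
maximal above `p`), the short exact sequence of coefficients
`0 → ℤ/p^a —(× p^b)→ ℤ/p^{a+b} —red→ ℤ/p^b → 0` (`ModPowSeq.mul`, `ModPowSeq.red`,
`ModPowSeq.exact_mul_red`) gives a short exact sequence of level-action representations
(`coeffSeq_shortExact`, via `shortExact_pushforward`) on which every Hecke operator acts
(`coeffSeqHecke`), whence, for the annihilator bookkeeping `LaKills` of
`LevelActionAnnihilatorTransport`:

* **`laKills_of_mul`** — in degree `1`, `(× p^b)_* : H¹(ℤ/p^a) → H¹(ℤ/p^{a+b})` is injective on the
  ordinary part as soon as some `U_{v₀,1}` is nilpotent on `H⁰(ℤ/p^b)` (its kernel is `∂ H⁰`), so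
  `LaKills` descends from `ℤ/p^{a+b}` to `ℤ/p^a`;
* **`laKills_mul_C_of_red`** — in degree `2`, `red_* : H²(ℤ/p^{a+b}) → H²(ℤ/p^b)` is surjective up
  to `N` as soon as `N` kills `H³(ℤ/p^a)` (its cokernel embeds into `H³`), so `LaKills z` at
  `ℤ/p^{a+b}` gives `LaKills (N z)` at `ℤ/p^b`.

[cite: Hida1994AIF, §3, proof of Thm 3.2] [cite: KhareThorne2017, §6.3–6.5]

## References

* H. Hida, Ann. Inst. Fourier 44 (1994), §3. [Hida1994AIF]
* C. Khare, J. A. Thorne, Amer. J. Math. 139 (2017), §6.3–6.5. [KhareThorne2017]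
-/

noncomputable section

open CategoryTheory IsDedekindDomain groupCohomology
open scoped NumberField

namespace Literature.NumberTheory.Automorphic

/-! ### The maps `ℤ/p^a → ℤ/p^{a+b} → ℤ/p^b` -/

namespace ModPowSeq

variable (k : Type) [CommRing k] (ϖ : k)

/-- `span {ϖ^{a+b}} ≤ span {ϖ^b}`. [folklore] -/
theorem span_le (a b : ℕ) : (Ideal.span {ϖ ^ (a + b)} : Ideal k) ≤ Ideal.span {ϖ ^ b} :=
  Ideal.span_singleton_le_span_singleton.2 (pow_dvd_pow ϖ (Nat.le_add_left b a))

/-- **Multiplication by `ϖ^b`: `k/ϖ^a → k/ϖ^{a+b}`.** [folklore] -/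
def mul (a b : ℕ) : modPow k ϖ a →ₗ[k] modPow k ϖ (a + b) :=
  (Ideal.span {ϖ ^ a}).liftQ ((Ideal.span {ϖ ^ (a + b)}).mkQ ∘ₗ ((ϖ ^ b) • LinearMap.id)) (by
    intro x hx
    obtain ⟨y, rfl⟩ := Ideal.mem_span_singleton'.1 hx
    rw [LinearMap.mem_ker, LinearMap.comp_apply, LinearMap.smul_apply, LinearMap.id_apply,
      Submodule.mkQ_apply, Submodule.Quotient.mk_eq_zero]
    exact Ideal.mem_span_singleton'.2 ⟨y, by rw [smul_eq_mul]; ring⟩)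

/-- `mul (x mod ϖ^a) = ϖ^b x mod ϖ^{a+b}`. [folklore] -/
theorem mul_mk (a b : ℕ) (x : k) :
    mul k ϖ a b (Submodule.Quotient.mk x) = Submodule.Quotient.mk (ϖ ^ b * x) :=
  rfl

/-- **Reduction `k/ϖ^{a+b} → k/ϖ^b`.** [folklore] -/
def red (a b : ℕ) : modPow k ϖ (a + b) →ₗ[k] modPow k ϖ b :=
  Submodule.factor (span_le k ϖ a b)

/-- `red (x mod ϖ^{a+b}) = x mod ϖ^b`. [folklore] -/
theorem red_mk (a b : ℕ) (x : k) : red k ϖ a b (Submodule.Quotient.mk x) = Submodule.Quotient.mk x :=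
  Submodule.factor_mk (span_le k ϖ a b) x

/-- `red` is surjective. [folklore] -/
theorem red_surjective (a b : ℕ) : Function.Surjective (red k ϖ a b) :=
  Submodule.factor_surjective (span_le k ϖ a b)

/-- `mul` is injective when `ϖ^b` is a non-zero-divisor. [folklore] -/
theorem mul_injective (a b : ℕ) (hϖ : ∀ x : k, ϖ ^ b * x = 0 → x = 0) : Function.Injective (mul k ϖ a b) := by
  rw [injective_iff_map_eq_zero]
  intro x hx
  induction x using Submodule.Quotient.induction_on with
  | H x =>
    rw [mul_mk, Submodule.Quotient.mk_eq_zero] at hx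
    obtain ⟨y, hy⟩ := Ideal.mem_span_singleton'.1 hx
    rw [Submodule.Quotient.mk_eq_zero]
    refine Ideal.mem_span_singleton'.2 ⟨y, ?_⟩
    have h0 : ϖ ^ b * (y * ϖ ^ a - x) = 0 := by rw [mul_sub, ← hy]; ring
    exact (sub_eq_zero.1 (hϖ _ h0))

/-- **Exactness of `k/ϖ^a → k/ϖ^{a+b} → k/ϖ^b`.** [folklore] -/
theorem exact_mul_red (a b : ℕ) : Function.Exact (mul k ϖ a b) (red k ϖ a b) := by
  intro y
  induction y using Submodule.Quotient.induction_on with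
  | H x =>
    rw [red_mk, Submodule.Quotient.mk_eq_zero]
    constructor
    · intro hx
      obtain ⟨y, rfl⟩ := Ideal.mem_span_singleton'.1 hx
      exact ⟨Submodule.Quotient.mk y, by rw [mul_mk, mul_comm]⟩
    · rintro ⟨y, hy⟩
      induction y using Submodule.Quotient.induction_on with
      | H y =>
        rw [mul_mk, Submodule.Quotient.eq] at hy
        have h := span_le k ϖ a b hy
        have h' : ϖ ^ b * y ∈ Ideal.span {ϖ ^ b} := Ideal.mem_span_singleton'.2 ⟨y, mul_comm _ _⟩
        simpa using sub_mem h' h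

end ModPowSeq

/-! ### The coefficient sequences of the level-action model -/

namespace BigHeckeGLn

namespace TameLevel

open LevelAction

variable (k : Type) [CommRing k] {K : Type} [Field K] [NumberField K] {p : ℕ} [Fact p.Prime]
  (𝒰 : TameLevel 2 K p)

/-- The trivial action of `GL₂(𝔸^∞)` on `k/p^t`. [folklore] -/
abbrev trivCoeff (t : ℕ) : (⊤ : Submonoid (FiniteAdelicGL 2 K)) →* Module.End k (modPow k (p : k) t) := 1

omit [Fact p.Prime] in
/-- Every linear map of trivial coefficient modules is equivariant. [folklore] -/
theorem trivCoeff_comm {t t' : ℕ} (φ : modPow k (p : k) t →ₗ[k] modPow k (p : k) t')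
    (δ : (⊤ : Submonoid (FiniteAdelicGL 2 K))) :
    φ ∘ₗ trivCoeff k (K := K) (p := p) t δ = trivCoeff k (K := K) (p := p) t' δ ∘ₗ φ := rfl

/-- **The short exact sequence `0 → M(U(b',c'), ℤ/p^a) → M(U(b',c'), ℤ/p^{a+b}) → M(U(b',c'), ℤ/p^b) → 0`**
of level-action representations. [cite: KhareThorne2017, §6.3] [cite: Hida1994AIF, §1] -/
def coeffSeq (b' c' a b : ℕ) : ShortComplex (Rep k (GL (Fin 2) K)) :=
  ShortComplex.mk
    (pushforward (globalEmbedding 2 K) ⊤ (trivCoeff k a) (trivCoeff k (a + b)) (𝒰.level b' c')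
      (ModPowSeq.mul k (p : k) a b) (trivCoeff_comm k _))
    (pushforward (globalEmbedding 2 K) ⊤ (trivCoeff k (a + b)) (trivCoeff k b) (𝒰.level b' c')
      (ModPowSeq.red k (p : k) a b) (trivCoeff_comm k _))
    (pushforward_comp_pushforward_eq_zero (globalEmbedding 2 K) (trivCoeff k a) (trivCoeff k (a + b))
      (trivCoeff k b) (ModPowSeq.mul k (p : k) a b) (ModPowSeq.red k (p : k) a b) (trivCoeff_comm k _)
      (trivCoeff_comm k _)
      (LinearMap.ext fun v => ((ModPowSeq.exact_mul_red k (p : k) a b) (ModPowSeq.mul k (p : k) a b v)).2 ⟨v, rfl⟩))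

/-- It is short exact when `p^b` is a non-zero-divisor of `k`. [cite: KhareThorne2017, §6.3] -/
theorem coeffSeq_shortExact (b' c' a b : ℕ) (hreg : ∀ x : k, (p : k) ^ b * x = 0 → x = 0) :
    (𝒰.coeffSeq k b' c' a b).ShortExact :=
  shortExact_pushforward (globalEmbedding 2 K) (trivCoeff k a) (trivCoeff k (a + b)) (trivCoeff k b)
    (Δ := ⊤) (W := 𝒰.level b' c') le_top (ModPowSeq.mul k (p : k) a b) (ModPowSeq.red k (p : k) a b)
    (trivCoeff_comm k _) (trivCoeff_comm k _) (ModPowSeq.mul_injective k (p : k) a b hreg)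
    (ModPowSeq.red_surjective k (p : k) a b) (ModPowSeq.exact_mul_red k (p : k) a b)

/-- **The Hecke operator `[U g U]` as an endomorphism of the coefficient sequence.** [folklore] -/
def coeffSeqHecke (b' c' a b : ℕ) (g : FiniteAdelicGL 2 K) : 𝒰.coeffSeq k b' c' a b ⟶ 𝒰.coeffSeq k b' c' a b :=
  ShortComplex.homMk
    (heckeRepHom (globalEmbedding 2 K) ⊤ (trivCoeff k a) (𝒰.level b' c') le_top (Submonoid.mem_top g))
    (heckeRepHom (globalEmbedding 2 K) ⊤ (trivCoeff k (a + b)) (𝒰.level b' c') le_top (Submonoid.mem_top g))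
    (heckeRepHom (globalEmbedding 2 K) ⊤ (trivCoeff k b) (𝒰.level b' c') le_top (Submonoid.mem_top g))
    (heckeRepHom_comp_pushforward (globalEmbedding 2 K) ⊤ _ _ (𝒰.level b' c') _ (trivCoeff_comm k _) le_top
      (Submonoid.mem_top g))
    (heckeRepHom_comp_pushforward (globalEmbedding 2 K) ⊤ _ _ (𝒰.level b' c') _ (trivCoeff_comm k _) le_top
      (Submonoid.mem_top g))

/-- `(× p^b)_* : H^i(U(b',c'), 1; k/p^a) → H^i(U(b',c'), 1; k/p^{a+b})`. [folklore] -/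
abbrev mulCohomology (b' c' a b i : ℕ) : 𝒰.laCohomology k b' c' a i →ₗ[k] 𝒰.laCohomology k b' c' (a + b) i :=
  (pushforwardCohomology (globalEmbedding 2 K) ⊤ (trivCoeff k a) (trivCoeff k (a + b)) (𝒰.level b' c')
    (ModPowSeq.mul k (p : k) a b) (trivCoeff_comm k _) i).hom

/-- `red_* : H^i(U(b',c'), 1; k/p^{a+b}) → H^i(U(b',c'), 1; k/p^b)`. [folklore] -/
abbrev redCohomology (b' c' a b i : ℕ) : 𝒰.laCohomology k b' c' (a + b) i →ₗ[k] 𝒰.laCohomology k b' c' b i :=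
  (pushforwardCohomology (globalEmbedding 2 K) ⊤ (trivCoeff k (a + b)) (trivCoeff k b) (𝒰.level b' c')
    (ModPowSeq.red k (p : k) a b) (trivCoeff_comm k _) i).hom

/-- `(× p^b)_*` commutes with every Hecke operator. [folklore] -/
theorem mulCohomology_comp_laHecke (b' c' a b i : ℕ) (g : FiniteAdelicGL 2 K) :
    𝒰.mulCohomology k b' c' a b i ∘ₗ 𝒰.laHecke k b' c' a g i =
      𝒰.laHecke k b' c' (a + b) g i ∘ₗ 𝒰.mulCohomology k b' c' a b i :=
  heckeCohomology_comp_pushforwardCohomology (globalEmbedding 2 K) ⊤ _ _ (𝒰.level b' c') _ (trivCoeff_comm k _)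
    le_top (Submonoid.mem_top g) i

/-- `red_*` commutes with every Hecke operator. [folklore] -/
theorem redCohomology_comp_laHecke (b' c' a b i : ℕ) (g : FiniteAdelicGL 2 K) :
    𝒰.redCohomology k b' c' a b i ∘ₗ 𝒰.laHecke k b' c' (a + b) g i =
      𝒰.laHecke k b' c' b g i ∘ₗ 𝒰.redCohomology k b' c' a b i :=
  heckeCohomology_comp_pushforwardCohomology (globalEmbedding 2 K) ⊤ _ _ (𝒰.level b' c') _ (trivCoeff_comm k _)
    le_top (Submonoid.mem_top g) i

/-- `p^b` is a non-zero-divisor of `ℤ`. [folklore] -/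
theorem int_pow_mul_eq_zero (b : ℕ) (x : ℤ) (h : (p : ℤ) ^ b * x = 0) : x = 0 :=
  (mul_eq_zero.1 h).resolve_left (pow_ne_zero _ (Int.natCast_ne_zero.2 (Fact.out : p.Prime).ne_zero))

/-! ### Degree one: `(× p^b)_*` is injective on the ordinary part -/

/-- If `U^m x = 0` for `x ∈ ⋂ₙ Uⁿ M` of a finite module then `x = 0`. [folklore] -/
theorem eq_zero_of_pow_apply_eq_zero_of_mem_iInf {M : Type} [AddCommGroup M] [Module ℤ M] [Finite M]
    (U : Module.End ℤ M) {m : ℕ} {x : M} (hx : x ∈ (⨅ n, LinearMap.range (U ^ n) : Submodule ℤ M))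
    (h0 : (U ^ m) x = 0) : x = 0 := by
  induction m generalizing x with
  | zero => rwa [pow_zero, Module.End.one_apply] at h0
  | succ m ih =>
    have hUx : U x ∈ (⨅ n, LinearMap.range (U ^ n) : Submodule ℤ M) :=
      mapsTo_iInf_range_pow_of_comp_eq (rfl : U ∘ₗ U = U ∘ₗ U) hx
    have h1 : (U ^ m) (U x) = 0 := by rwa [pow_succ, Module.End.mul_apply] at h0
    have hU0 := ih hUx h1
    exact (OrdFinite.bijOn_iInf_range_pow U).injOn hx (Submodule.zero_mem _) (by rw [hU0, map_zero])

/-- **`LaKills` descends along `(× p^b)_*` in degree one**: if some `U_{v₀,1}` is nilpotent on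
`H⁰(U(b',c'), 1; ℤ/p^b)`, then `(× p^b)_* : H¹(ℤ/p^a) → H¹(ℤ/p^{a+b})` is injective on the ordinary
part (its kernel is `∂ H⁰(ℤ/p^b)`, on which `U_{v₀,1}` is nilpotent), and `LaKills z` at `ℤ/p^{a+b}`
implies `LaKills z` at `ℤ/p^a`. [cite: Hida1994AIF, §3, proof of Thm 3.2] -/
theorem laKills_of_mul [Fact 𝒰.IsMaximalAbove] {b' c' a b : ℕ} [Finite (𝒰.laCohomology ℤ b' c' a 1)]
    (v₀ : PlacesAbove K p) {m : ℕ}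
    (h₃ : 𝒰.laHecke ℤ b' c' b (heckeElement 2 K v₀.1 1) 0 ^ m = 0)
    (z : MvPolynomial 𝒰.hidaElements ℤ) (hz : 𝒰.LaKills b' c' (a + b) 1 z) : 𝒰.LaKills b' c' a 1 z := by
  refine 𝒰.laKills_of_injOn (𝒰.mulCohomology ℤ b' c' a b 1)
    (fun g _ => 𝒰.mulCohomology_comp_laHecke ℤ b' c' a b 1 g) (fun x hx hx0 => ?_) z hz
  -- `x ∈ ker (× p^b)_* = ∂ H⁰(ℤ/p^b)` is killed by `U_{v₀}^m`
  have hK := LevelControl.pow_map_apply_eq_zero_of_map_f_eq_zero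
    (𝒰.coeffSeq_shortExact ℤ b' c' a b (int_pow_mul_eq_zero b))
    (𝒰.coeffSeqHecke ℤ b' c' a b (heckeElement 2 K v₀.1 1)) (i := 0) (j := 1) rfl (m := m)
    (fun y => by
      change (𝒰.laHecke ℤ b' c' b (heckeElement 2 K v₀.1 1) 0 ^ m) y = 0
      rw [h₃, LinearMap.zero_apply]) x hx0
  change (𝒰.laHecke ℤ b' c' a (heckeElement 2 K v₀.1 1) 1 ^ m) x = 0 at hK
  have hx' : x ∈ (⨅ n, LinearMap.range (𝒰.laHecke ℤ b' c' a (heckeElement 2 K v₀.1 1) 1 ^ n) :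
      Submodule ℤ _) := by
    simp only [laOrd, Submodule.mem_iInf] at hx
    exact (Submodule.mem_iInf _).2 (hx v₀)
  exact eq_zero_of_pow_apply_eq_zero_of_mem_iInf _ hx' hK

/-! ### Degree two: `red_*` is surjective up to the exponent of `H³` -/

/-- **`N • H²(ℤ/p^b) ⊆ red_* H²(ℤ/p^{a+b})` if `N` kills `H³(U(b',c'), 1; ℤ/p^a)`** (long exact
sequence). [cite: Hida1994AIF, §3] -/
theorem exists_redCohomology_eq_nsmul {b' c' a b : ℕ} {N : ℕ}
    (hN : ∀ w : 𝒰.laCohomology ℤ b' c' a 3, N • w = 0) (y : 𝒰.laCohomology ℤ b' c' b 2) :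
    ∃ x, 𝒰.redCohomology ℤ b' c' a b 2 x = N • y := by
  have hex := (ShortComplex.moduleCat_exact_iff _).1
    (mapShortComplex₃_exact (𝒰.coeffSeq_shortExact ℤ b' c' a b (int_pow_mul_eq_zero b)) (rfl : 2 + 1 = 3))
  obtain ⟨x, hx⟩ := hex (N • y) ((map_nsmul (ConcreteCategory.hom (mapShortComplex₃
    (𝒰.coeffSeq_shortExact ℤ b' c' a b (int_pow_mul_eq_zero b)) (rfl : 2 + 1 = 3)).g) N y).trans (hN _))
  exact ⟨x, hx⟩

/-- **`LaKills` passes along `red_*` in degree two up to the exponent of `H³`**: if `N` kills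
`H³(U(b',c'), 1; ℤ/p^a)` then `LaKills z` at `ℤ/p^{a+b}` implies `LaKills (N z)` at `ℤ/p^b`
(finite cohomology). [cite: Hida1994AIF, §3, proof of Thm 3.2] -/
theorem laKills_mul_C_of_red [Fact 𝒰.IsMaximalAbove] {b' c' a b : ℕ}
    [Finite (𝒰.laCohomology ℤ b' c' (a + b) 2)] [Finite (𝒰.laCohomology ℤ b' c' b 2)] {N : ℕ}
    (hN : ∀ w : 𝒰.laCohomology ℤ b' c' a 3, N • w = 0)
    (z : MvPolynomial 𝒰.hidaElements ℤ) (hz : 𝒰.LaKills b' c' (a + b) 2 z) :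
    𝒰.LaKills b' c' b 2 (MvPolynomial.C (N : ℤ) * z) :=
  𝒰.laKills_mul_C_of_surjOn (𝒰.redCohomology ℤ b' c' a b 2)
    (fun g _ => 𝒰.redCohomology_comp_laHecke ℤ b' c' a b 2 g)
    (fun _ hy => 𝒰.exists_mem_laOrd_map_eq_nsmul (𝒰.redCohomology ℤ b' c' a b 2)
      (fun g _ => 𝒰.redCohomology_comp_laHecke ℤ b' c' a b 2 g) (𝒰.exists_redCohomology_eq_nsmul hN) hy)
    z hz

end TameLevel

end BigHeckeGLn

end Literature.NumberTheory.Automorphic
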